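import Literature.NumberTheory.Automorphic.UnramifiedIntegralConjugacySemisimple
import Literature.NumberTheory.Automorphic.UnramifiedOrbitalUnitFactorSemisimple
import Literature.NumberTheory.Rogawski1990.SingularSemisimpleElement
import Literature.NumberTheory.Rogawski1990.AdelicStableClassesProductOfKConj
import HarnessLib

/-!
# «γ′_v is conjugate to γ by an element of `K_v` for almost all `v`» at a SEMISIMPLE (possibly SINGULAR) class of `U(3)` — the `K_v`-conjugacy
# clause (KC) is a theorem at every semisimple rational element (Rogawski 1990, §3.3 p. 21, §3.8 p. 27; Kottwitz 1986, Prop. 7.1 ∕ §7.3)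

Topic `NumberTheory/Rogawski1990`; namespace `Literature.NumberTheory.Rogawski1990`; THEOREMS ONLY (no definition, no instance, no named fact, no `sorry`).
The CM dress of ★ `UnitaryGroup.eventually_forall_integralConj_of_mul_sub_eq_zero` (`Automorphic/UnramifiedIntegralConjugacySemisimple`) and the
trichotomy of a semisimple `γ ∈ U(H)(L⁺) ≤ GL₃(L)`: REGULAR (separable characteristic polynomial — ★ `UnitaryGroup.eventually_integralConj_of_isRegularElt`),
SCALAR (central: a `GL`-conjugate of `γ_v` IS `γ_v`), or SINGULAR NON-CENTRAL: `(γ − a)(γ − b) = 0` with `a ≠ b ∈ L`, `a ā = b b̄ = 1` (★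
`exists_eigenpair_of_isSemisimple_of_not_separable`, ★ `exists_singular_frame`).  The conclusion is O7 OWNER WORD #1 (A) — the (KC) binder `hKγ` of ★ K6-β
`UnramifiedOrbitalUnitFactorSemisimple` :126–130 and, through ★ `MatchingAdeleG.eventuallyKConj_of_isConj_toLocal`, the pair-level clause `hKCγ` of ★ K6-δ
`AdelicStableClassesProductOfKConj` (★ `MatchingAdeleGEventuallyKConj` :396–410 with `IsRegularElt ↦ IsSemisimpleElt`).

* §1 `eventually_forall_integralConj_cmDatum_of_mul_sub_eq_zero` (any `N`: the quadratic-relation case), `exists_integralConj_cmDatum_of_eq_smul_one` (any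
  `N`, every `v`: the scalar case);
* §2 **`eventually_forall_integralConj_cmDatum_of_isSemisimpleElt`** — (KC) at every SEMISIMPLE rational `γ ∈ U(H)(L⁺)`, `N = 3`, `H` hermitian with
  `det H ≠ 0`; `…_of_isStablyConj` (at every `δ` stably conjugate to a semisimple `γ₀`);
* §3 **`MatchingAdeleG.eventuallyKConj_of_isSemisimpleElt`** — the pair-level clause for `γ₀ ∈ U(H)(L⁺)` semisimple and `γ₀ ↔ γ ∈ U(Φ₃)(L⁺)`.

## References
* [Rogawski1990] J. D. Rogawski, *Automorphic Representations of Unitary Groups in Three Variables*, Ann. of Math. Stud. 123 (1990), §3.3 p. 21, §3.8 p. 27.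
* [Kottwitz1986] R. E. Kottwitz, *Stable trace formula: elliptic singular terms*, Math. Ann. 275 (1986), Prop. 7.1, §7.3.
-/

set_option autoImplicit false

noncomputable section

open NumberField IsDedekindDomain Filter
open scoped Matrix MatrixGroups

namespace Literature.NumberTheory.Rogawski1990

open Literature.NumberTheory.Automorphic Literature.NumberTheory.Automorphic.UnitaryGroup

/-! ## §1 The quadratic-relation case and the scalar case (any `N`) -/

section AnyN

variable (L : Type) [Field L] [NumberField L] [IsCMField L] (N : ℕ) (H : Matrix (Fin N) (Fin N) L)

/-- **(KC) at a rational `γ ∈ U(H)(L⁺)` with `(γ − a)(γ − b) = 0`, `a ≠ b`, `a ā = b b̄ = 1`** (CM dress of ★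
`UnitaryGroup.eventually_forall_integralConj_of_mul_sub_eq_zero`): for `H` hermitian with `det H ≠ 0`, for all but finitely many finite places `v` of `L⁺`, every
`g′ ∈ K_v = U(H)(𝒪_v)` conjugate to `γ_v` in `GL_N(L ⊗ L⁺_v)` satisfies `k γ_v k⁻¹ = g′` for some `k ∈ K_v`. [cite: Kottwitz1986, Prop. 7.1; §7.3]
[cite: Rogawski1990, §3.3 p. 21; §3.8 p. 27] -/
theorem eventually_forall_integralConj_cmDatum_of_mul_sub_eq_zero (hH : (H.map (cmConjRingHom L))ᵀ = H) (hHd : H.det ≠ 0)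
    (γ : (cmDatum L N H).Rational) {a b : L} (hab : a ≠ b)
    (hγab : (((γ.val : GL (Fin N) L) : Matrix (Fin N) (Fin N) L) - a • 1) * (((γ.val : GL (Fin N) L) : Matrix (Fin N) (Fin N) L) - b • 1) = 0)
    (ha : a * cmConjRingHom L a = 1) (hb : b * cmConjRingHom L b = 1) :
    ∀ᶠ v : HeightOneSpectrum (𝓞 ↥(maximalRealSubfield L)) in Filter.cofinite,
      ∀ g' : (cmDatum L N H).Local v, g' ∈ cmLocalIntegralLevel L N H v →
        IsConj (g'.val : GL (Fin N) (LocalRing L v))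
          (((cmDatum L N H).toLocal v ((cmDatum L N H).toAdelic γ)).val : GL (Fin N) (LocalRing L v)) →
          ∃ k ∈ cmLocalIntegralLevel L N H v, k * (cmDatum L N H).toLocal v ((cmDatum L N H).toAdelic γ) * k⁻¹ = g' :=
  eventually_forall_integralConj_of_mul_sub_eq_zero (IsCMField.complexConj L) N H (IsCMField.complexConj_ne_one L) hH
    (isUnit_iff_ne_zero.2 hHd) (γ.val : GL (Fin N) L) hab hγab ha hb (fun v => (cmDatum L N H).toLocal v ((cmDatum L N H).toAdelic γ))
    (fun v => coe_cmDatum_toLocal_toAdelic L N H v γ)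

/-- **(KC) at a SCALAR rational `γ = ζ · 1 ∈ U(H)(L⁺)`, at EVERY place**: `γ_v` is central in `GL_N(L ⊗ L⁺_v)`, so an element `GL`-conjugate to `γ_v` IS `γ_v`,
and `k = 1` serves. [cite: Rogawski1990, §3.8 p. 27] -/
theorem exists_integralConj_cmDatum_of_eq_smul_one (γ : (cmDatum L N H).Rational) {ζ : L}
    (hγ : ((γ.val : GL (Fin N) L) : Matrix (Fin N) (Fin N) L) = ζ • 1) (v : HeightOneSpectrum (𝓞 ↥(maximalRealSubfield L)))
    (g' : (cmDatum L N H).Local v)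
    (hconj : IsConj (g'.val : GL (Fin N) (LocalRing L v)) (((cmDatum L N H).toLocal v ((cmDatum L N H).toAdelic γ)).val : GL (Fin N) (LocalRing L v))) :
    ∃ k ∈ cmLocalIntegralLevel L N H v, k * (cmDatum L N H).toLocal v ((cmDatum L N H).toAdelic γ) * k⁻¹ = g' := by
  refine ⟨1, one_mem _, ?_⟩
  rw [one_mul, inv_one, mul_one]
  obtain ⟨C, hC⟩ := isConj_iff.1 hconj
  -- `γ_v = ζ ⊗ 1` is central in `GL_N(L ⊗ L⁺_v)`
  have hcen : (((cmDatum L N H).toLocal v ((cmDatum L N H).toAdelic γ)).val : GL (Fin N) (UnitaryGroup.LocalRing L v)).val =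
      algebraMap L (UnitaryGroup.LocalRing L v) ζ • (1 : Matrix (Fin N) (Fin N) (UnitaryGroup.LocalRing L v)) := by
    rw [coe_cmDatum_toLocal_toAdelic, coe_toLocalGL_apply, hγ, Matrix.map_smul' _ _ _ (map_mul _), Matrix.map_one _ (map_zero _) (map_one _)]
  have hg' : (g'.val : GL (Fin N) (UnitaryGroup.LocalRing L v)) = C⁻¹ * ((cmDatum L N H).toLocal v ((cmDatum L N H).toAdelic γ)).val * C := by
    rw [← hC, ← mul_assoc, ← mul_assoc, inv_mul_cancel, one_mul, inv_mul_cancel_right]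
  apply Subtype.ext
  rw [hg']
  refine Units.ext ?_
  rw [Units.val_mul, Units.val_mul, hcen, Matrix.mul_smul, Matrix.mul_one, Matrix.smul_mul, Units.inv_mul]

end AnyN

/-! ## §2 (KC) at every semisimple rational element of `U(3)` -/

/-- Two polynomial factors of `M` commute: `(M − β)(M − α) = (M − α)(M − β)`. [folklore] -/
private theorem sub_smul_one_mul_comm {R : Type*} [CommRing R] {n : Type*} [Fintype n] [DecidableEq n] (M : Matrix n n R) (α β : R) :
    (M - β • (1 : Matrix n n R)) * (M - α • 1) = (M - α • 1) * (M - β • 1) := by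
  simp only [sub_mul, mul_sub, Matrix.mul_smul, Matrix.smul_mul, Matrix.mul_one, Matrix.one_mul, smul_smul, mul_comm β α]
  abel

section Three

variable (L : Type) [Field L] [NumberField L] [IsCMField L] (H : Matrix (Fin 3) (Fin 3) L)

/-- **O7 OWNER WORD #1 (A): the `K_v`-conjugacy clause (KC) at every SEMISIMPLE rational `γ ∈ U(H)(L⁺)`, `N = 3`** (`H` hermitian, `det H ≠ 0`): for all but
finitely many finite places `v` of `L⁺`, every `g′ ∈ K_v = U(H)(𝒪_v)` which is `GL₃(L ⊗ L⁺_v)`-conjugate to `γ_v` satisfies `k γ_v k⁻¹ = g′` for some `k ∈ K_v` —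
«`γ′_v` is conjugate to `γ` by an element of `K_v` for almost all `v` … by [Kt₄], Proposition 7.1» WITHOUT the regularity of `γ`.  Trichotomy: REGULAR (★
`UnitaryGroup.eventually_integralConj_of_isRegularElt`), SCALAR (§1, every `v`), SINGULAR NON-CENTRAL — eigenvalues `{a, a, b}`, `(γ − a)(γ − b) = 0`,
`a ā = b b̄ = 1` (★ `exists_eigenpair_of_isSemisimple_of_not_separable`, ★ `exists_singular_frame`) — §1 over ★ `IntegralConjugacyOfIdempotents` (split places) and ★
`IntegralUnitaryConjugacyOfIdempotents` (inert places).  This is the binder `hKγ` of ★ `UnramifiedOrbitalUnitFactorSemisimple` DISCHARGED.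
[cite: Rogawski1990, §3.3 p. 21; §3.8 p. 27] [cite: Kottwitz1986, Prop. 7.1; §7.3] -/
theorem eventually_forall_integralConj_cmDatum_of_isSemisimpleElt (hH : (H.map (cmConjRingHom L))ᵀ = H) (hHd : H.det ≠ 0)
    (γ : (cmDatum L 3 H).Rational) (hγ : IsSemisimpleElt (cmConjRingHom L) H γ) :
    ∀ᶠ v : HeightOneSpectrum (𝓞 ↥(maximalRealSubfield L)) in Filter.cofinite,
      ∀ g' : (cmDatum L 3 H).Local v, g' ∈ cmLocalIntegralLevel L 3 H v →
        IsConj (g'.val : GL (Fin 3) (LocalRing L v))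
          (((cmDatum L 3 H).toLocal v ((cmDatum L 3 H).toAdelic γ)).val : GL (Fin 3) (LocalRing L v)) →
          ∃ k ∈ cmLocalIntegralLevel L 3 H v, k * (cmDatum L 3 H).toLocal v ((cmDatum L 3 H).toAdelic γ) * k⁻¹ = g' := by
  by_cases hreg : IsRegularElt (γ.val : GL (Fin 3) L)
  · exact UnitaryGroup.eventually_integralConj_of_isRegularElt L 3 H hH hHd γ hreg
  by_cases hsc : ∃ ζ : L, ((γ.val : GL (Fin 3) L) : Matrix (Fin 3) (Fin 3) L) = ζ • 1
  · obtain ⟨ζ, hζ⟩ := hsc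
    exact Filter.Eventually.of_forall fun v g' _ hconj => exists_integralConj_cmDatum_of_eq_smul_one L 3 H γ hζ v g' hconj
  push Not at hsc
  -- singular, non-central: eigenvalues `{a, a, b}`
  obtain ⟨α, β, hαβ, hγαβ, hα, hβ⟩ := exists_eigenpair_of_isSemisimple_of_not_separable ((γ.val : GL (Fin 3) L) : Matrix (Fin 3) (Fin 3) L) hγ
    (fun h => hreg ((isRegularElt_iff _).2 h)) hsc
  obtain ⟨a, b, -, -, -, hab, haa, hbb, -⟩ := exists_singular_frame (cmConjRingHom L) (IsCMField.complexConj_apply_apply L) H hH hHd γ hαβ hγαβ hα hβ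
  have hab' : a ≠ b := by
    rcases hab with ⟨rfl, rfl⟩ | ⟨rfl, rfl⟩
    · exact hαβ
    · exact hαβ.symm
  have hγab : (((γ.val : GL (Fin 3) L) : Matrix (Fin 3) (Fin 3) L) - a • 1) * (((γ.val : GL (Fin 3) L) : Matrix (Fin 3) (Fin 3) L) - b • 1) = 0 := by
    rcases hab with ⟨rfl, rfl⟩ | ⟨rfl, rfl⟩
    · exact hγαβ
    · rw [sub_smul_one_mul_comm]; exact hγαβ
  exact eventually_forall_integralConj_cmDatum_of_mul_sub_eq_zero L 3 H hH hHd γ hab' hγab (by rw [mul_comm]; exact haa) (by rw [mul_comm]; exact hbb)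

variable {L H} in
/-- **(KC) at every element STABLY CONJUGATE to a semisimple one** (semisimplicity is a property of the stable class, ★ `IsStablyConj.isSemisimpleElt_iff`): the
binder `hKδ` of ★ `MatchingAdeleG₂.isRationalOver_of_isConj_arch_of_forall_isConj_toLocal_of_integralConj` at every `δ ∼_st γ₀`. [cite: Rogawski1990, §3.3 p. 21; §3.8 p. 27] -/
theorem eventually_forall_integralConj_cmDatum_of_isStablyConj (hH : (H.map (cmConjRingHom L))ᵀ = H) (hHd : H.det ≠ 0)
    {γ₀ δ : (cmDatum L 3 H).Rational} (hγ₀ : IsSemisimpleElt (cmConjRingHom L) H γ₀) (hst : IsStablyConj (cmConjRingHom L) H γ₀ δ) :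
    ∀ᶠ v : HeightOneSpectrum (𝓞 ↥(maximalRealSubfield L)) in Filter.cofinite,
      ∀ g' : (cmDatum L 3 H).Local v, g' ∈ cmLocalIntegralLevel L 3 H v →
        IsConj (g'.val : GL (Fin 3) (LocalRing L v))
          (((cmDatum L 3 H).toLocal v ((cmDatum L 3 H).toAdelic δ)).val : GL (Fin 3) (LocalRing L v)) →
          ∃ k ∈ cmLocalIntegralLevel L 3 H v, k * (cmDatum L 3 H).toLocal v ((cmDatum L 3 H).toAdelic δ) * k⁻¹ = g' :=
  eventually_forall_integralConj_cmDatum_of_isSemisimpleElt L H hH hHd δ (hst.isSemisimpleElt_iff.1 hγ₀)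

end Three

/-! ## §3 The pair-level clause: `γ₀ ∈ U(H)(L⁺)` semisimple, `γ₀ ↔ γ ∈ U(Φ₃)(L⁺)` -/

section Pair

variable {L : Type} [Field L] [NumberField L] [IsCMField L] {H : Matrix (Fin 3) (Fin 3) L}
  {γ₀ : (UnitaryGroup.cmDatum L 3 H).Rational}
  {γ : (UnitaryGroup.cmDatum L 3 (Matrix.of fun i j : Fin 3 => if i.val + j.val + 1 = 3 then (1 : L) else 0)).Rational}

/-- **The clause of ★ `MatchingAdeleGEventuallyKConj` WITHOUT REGULARITY** — for `γ₀ ∈ U(H)(L⁺)` SEMISIMPLE with rational correspondent `γ ∈ U(Φ₃)(L⁺)`: for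
almost every finite place `v` of `L⁺`, every `g ∈ K_v = U(Φ₃)(𝒪_v)` corresponding to `(γ₀)_v` satisfies `k γ_v k⁻¹ = g` for some `k ∈ K_v` (§2 at the semisimple
`γ` — ★ `Corresponds.isSemisimpleElt_iff` — for the quasi-split `Φ₃`, ★ `antidiagOne_isHermitian` ∕ ★ `isUnit_antidiagOne_det`, read as the clause by ★
`MatchingAdeleG.eventuallyKConj_of_isConj_toLocal`): the hypothesis `hKCγ` of ★ `AdelicStableClassesProductOfKConj` ∕ K6-δ DISCHARGED at every semisimple pair.
«If `γ′ ∈ 𝒪_st(γ/𝐀)`, then `γ′_v` is conjugate to `γ` by an element of `K_v` for almost all `v`.» [cite: Rogawski1990, §3.3 p. 21; §3.8 p. 27] [cite: Kottwitz1986, Prop. 7.1] -/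
theorem MatchingAdeleG.eventuallyKConj_of_isSemisimpleElt (hss : IsSemisimpleElt (cmConjRingHom L) H γ₀)
    (hγ : Corresponds (cmConjRingHom L) H (Matrix.of fun i j : Fin 3 => if i.val + j.val + 1 = 3 then (1 : L) else 0) γ₀ γ) :
    ∀ᶠ v in cofinite, ∀ g : (UnitaryGroup.cmDatum L 3 (Matrix.of fun i j : Fin 3 => if i.val + j.val + 1 = 3 then (1 : L) else 0)).Local v,
      g ∈ UnitaryGroup.cmLocalIntegralLevel L 3 (Matrix.of fun i j : Fin 3 => if i.val + j.val + 1 = 3 then (1 : L) else 0) v →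
        Corresponds (UnitaryGroup.conjLocal L (IsCMField.complexConj L) v)
            ((UnitaryGroup.adelicForm L 3 H).map (UnitaryGroup.adeleToLocal L v))
            ((UnitaryGroup.adelicForm L 3 (Matrix.of fun i j : Fin 3 => if i.val + j.val + 1 = 3 then (1 : L) else 0)).map (UnitaryGroup.adeleToLocal L v))
            ((UnitaryGroup.cmDatum L 3 H).toLocal v ((UnitaryGroup.cmDatum L 3 H).toAdelic γ₀)) g →
          ∃ k ∈ UnitaryGroup.cmLocalIntegralLevel L 3 (Matrix.of fun i j : Fin 3 => if i.val + j.val + 1 = 3 then (1 : L) else 0) v,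
            k * (UnitaryGroup.cmDatum L 3 (Matrix.of fun i j : Fin 3 => if i.val + j.val + 1 = 3 then (1 : L) else 0)).toLocal v
                ((UnitaryGroup.cmDatum L 3 (Matrix.of fun i j : Fin 3 => if i.val + j.val + 1 = 3 then (1 : L) else 0)).toAdelic γ) * k⁻¹ = g :=
  MatchingAdeleG.eventuallyKConj_of_isConj_toLocal hγ
    (eventually_forall_integralConj_cmDatum_of_isSemisimpleElt L _ (antidiagOne_isHermitian L 3) (isUnit_antidiagOne_det (L := L) 3).ne_zero γ
      (hγ.isSemisimpleElt_iff.1 hss))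

end Pair

end Literature.NumberTheory.Rogawski1990

end
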